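import Literature.Probability.Percolation.KohlerSchindlerTassionRSW
import Literature.Probability.Percolation.CornerPercolation

/-!
# Stub `stub_cone3` of line `finite-size-envelope` (crux `CriticalPathRSW`), part 2:
open connections inside a box, in edge-label coordinates

Support file for item `stmt-CriticalPhenomena-10267` (stub `stub_cone3`, the pointwise one-sided
Russo cone for `M_3(ρ, c)`).  The self-refinement model labels the lattice edge `{v, v + e_d}` of
`ℤ²` by `(v, d) : Site 2 × Fin 2` (`cornerEdge`, `edgeConfig` of `CornerPercolation.lean`).  This
part is the elementary, model-free connectivity toolkit used by the local surgery arguments of the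
cone, phrased for a set `U` of OPEN LABELS, a vertex set `B` (the box) and two vertex sets `L`, `R`
(the sides).  To keep the file free of definitions everything is written with LOCAL NOTATIONS for
set-builder expressions (they are not declarations; every statement below is about the expanded
sets):

* `nbr⟪B, U, a⟫` — the vertices `b` such that `a, b ∈ B` are the two ends of an open label;
  `clus⟪B, U, a⟫` — the vertices joined to `a` by an open path inside `B` (a reflexive-transitive
  closure); `side⟪B, U, L⟫` — the vertices joined to the side `L`; `joined⟪B, L, R⟫` — the label
  configurations `U` for which some vertex of `L` is joined inside `B` to some vertex of `R`;
* the closure principle `Cone3.clus_subset_of_closed`, monotonicity and symmetry, the "last step"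
  lemma `Cone3.side_cases`, the dependence on in-box labels only (`Cone3.joined_congr`);
* **adding one open edge** (`Cone3.add_edge`): if `L ↮ R` but `L ↔ R` once the label `ℓ = {x, y}`
  is opened, then `x ↔ L` and `y ↔ R` (or the mirror);
* the one-step surgery `Cone3.one_step` (the walk version and the bridge to `KST2023.crossing`
  are in the companion file `…StubCone3GraphB`).

Everything is folklore graph theory (Grimmett 1999, §1.3, §2.4).
-/

noncomputable section

namespace Summit.CriticalPhenomena.CardyFormulaZ2.Cruxes.CriticalPathRSW.FiniteSizeEnvelope

open Set
open Literature.Probability.LatticeModels Literature.Probability.Percolation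

namespace Cone3

/-! ### Local notations

(`quotPrecheck` is switched off for them: Mathlib's set-builder syntax has no precheck handler.) -/

set_option quotPrecheck false

/-- Neighbours of `a` through an open label of `U`, inside `B`. -/
local notation "nbr⟪" B ", " U ", " a "⟫" =>
  {b : Site 2 | a ∈ B ∧ b ∈ B ∧ ∃ d : Fin 2,
    (b = a + Pi.single d 1 ∧ (a, d) ∈ U) ∨ (a = b + Pi.single d 1 ∧ (b, d) ∈ U)}

/-- The open cluster of `a` inside `B`. -/
local notation "clus⟪" B ", " U ", " a "⟫" =>
  {b : Site 2 | Relation.ReflTransGen (fun x y : Site 2 => y ∈ nbr⟪B, U, x⟫) a b}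

/-- The vertices joined inside `B` to the side `L`. -/
local notation "side⟪" B ", " U ", " L "⟫" => {v : Site 2 | ∃ a ∈ L, v ∈ clus⟪B, U, a⟫}

/-- The label configurations joining `L` to `R` inside `B`. -/
local notation "joined⟪" B ", " L ", " R "⟫" =>
  {U : Set (Site 2 × Fin 2) | ∃ a ∈ L, ∃ b ∈ R, b ∈ clus⟪B, U, a⟫}

/-- The labels with both ends in `B`. -/
local notation "labIn⟪" B "⟫" => {ℓ : Site 2 × Fin 2 | ℓ.1 ∈ B ∧ ℓ.1 + Pi.single ℓ.2 1 ∈ B}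

/-! ### Adjacency -/

/-- `a + e_d ≠ a` in `ℤ²`. -/
theorem add_single_ne (a : Site 2) (d : Fin 2) : a + Pi.single d 1 ≠ a := by
  intro h
  have h1 : (Pi.single d (1 : ℤ) : Site 2) = 0 := add_left_cancel (h.trans (add_zero a).symm)
  have := congr_fun h1 d
  simp at this

/-- Adjacency is symmetric. -/
theorem nbr_symm {B : Set (Site 2)} {U : Set (Site 2 × Fin 2)} {a b : Site 2} (h : b ∈ nbr⟪B, U, a⟫) :
    a ∈ nbr⟪B, U, b⟫ := by
  obtain ⟨ha, hb, d, h⟩ := h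
  exact ⟨hb, ha, d, h.symm⟩

/-- Adjacency is monotone in the set of open labels. -/
theorem nbr_mono {B : Set (Site 2)} {U U' : Set (Site 2 × Fin 2)} (hU : U ⊆ U') {a b : Site 2}
    (h : b ∈ nbr⟪B, U, a⟫) : b ∈ nbr⟪B, U', a⟫ := by
  obtain ⟨ha, hb, d, h | h⟩ := h
  · exact ⟨ha, hb, d, Or.inl ⟨h.1, hU h.2⟩⟩
  · exact ⟨ha, hb, d, Or.inr ⟨h.1, hU h.2⟩⟩

/-- Adjacency for a union of label sets. -/
theorem nbr_union_iff {B : Set (Site 2)} {U U' : Set (Site 2 × Fin 2)} {a b : Site 2} :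
    b ∈ nbr⟪B, U ∪ U', a⟫ ↔ b ∈ nbr⟪B, U, a⟫ ∨ b ∈ nbr⟪B, U', a⟫ := by
  constructor
  · rintro ⟨ha, hb, d, ⟨h1, h2 | h2⟩ | ⟨h1, h2 | h2⟩⟩
    · exact Or.inl ⟨ha, hb, d, Or.inl ⟨h1, h2⟩⟩
    · exact Or.inr ⟨ha, hb, d, Or.inl ⟨h1, h2⟩⟩
    · exact Or.inl ⟨ha, hb, d, Or.inr ⟨h1, h2⟩⟩
    · exact Or.inr ⟨ha, hb, d, Or.inr ⟨h1, h2⟩⟩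
  · rintro (h | h)
    · exact nbr_mono Set.subset_union_left h
    · exact nbr_mono Set.subset_union_right h

/-- The two ends of an adjacency through the single label `ℓ` are the two ends `ℓ.1`,
`ℓ.1 + e_{ℓ.2}` of `ℓ`. -/
theorem nbr_singleton_ends {B : Set (Site 2)} {ℓ : Site 2 × Fin 2} {a b : Site 2}
    (h : b ∈ nbr⟪B, ({ℓ} : Set (Site 2 × Fin 2)), a⟫) :
    (a = ℓ.1 ∧ b = ℓ.1 + Pi.single ℓ.2 1) ∨ (b = ℓ.1 ∧ a = ℓ.1 + Pi.single ℓ.2 1) := by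
  obtain ⟨-, -, d, ⟨h1, h2⟩ | ⟨h1, h2⟩⟩ := h
  · rw [Set.mem_singleton_iff] at h2
    subst h2
    exact Or.inl ⟨rfl, h1⟩
  · rw [Set.mem_singleton_iff] at h2
    subst h2
    exact Or.inr ⟨rfl, h1⟩

/-- If `p, q` are the ends of the label `ℓ`, every adjacency through `ℓ` ends at `p` or `q`. -/
theorem nbr_singleton_mem {B : Set (Site 2)} {ℓ : Site 2 × Fin 2} {p q a b : Site 2}
    (hpq : q ∈ nbr⟪B, ({ℓ} : Set (Site 2 × Fin 2)), p⟫) (h : b ∈ nbr⟪B, ({ℓ} : Set (Site 2 × Fin 2)), a⟫) :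
    b = p ∨ b = q := by
  rcases nbr_singleton_ends hpq with ⟨hp, hq⟩ | ⟨hq, hp⟩ <;>
    rcases nbr_singleton_ends h with ⟨-, hb⟩ | ⟨hb, -⟩
  · exact Or.inr (hb.trans hq.symm)
  · exact Or.inl (hb.trans hp.symm)
  · exact Or.inl (hb.trans hp.symm)
  · exact Or.inr (hb.trans hq.symm)

/-! ### Clusters -/

/-- `a ∈ clus⟪B, U, a⟫`. -/
theorem mem_clus_self {B : Set (Site 2)} {U : Set (Site 2 × Fin 2)} (a : Site 2) : a ∈ clus⟪B, U, a⟫ :=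
  Relation.ReflTransGen.refl

/-- Extending a connection by one adjacency. -/
theorem clus_step {B : Set (Site 2)} {U : Set (Site 2 × Fin 2)} {a b c : Site 2} (h : b ∈ clus⟪B, U, a⟫)
    (hbc : c ∈ nbr⟪B, U, b⟫) : c ∈ clus⟪B, U, a⟫ :=
  Relation.ReflTransGen.tail h hbc

/-- Transitivity of connection. -/
theorem clus_trans {B : Set (Site 2)} {U : Set (Site 2 × Fin 2)} {a b c : Site 2} (h : b ∈ clus⟪B, U, a⟫)
    (hbc : c ∈ clus⟪B, U, b⟫) : c ∈ clus⟪B, U, a⟫ :=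
  Relation.ReflTransGen.trans h hbc

/-- **Closure principle**: a set containing `a` and closed under adjacency contains the cluster
of `a`. -/
theorem clus_subset_of_closed {B : Set (Site 2)} {U : Set (Site 2 × Fin 2)} {Z : Set (Site 2)}
    (hZ : ∀ x y, x ∈ Z → y ∈ nbr⟪B, U, x⟫ → y ∈ Z) {a : Site 2} (ha : a ∈ Z) : clus⟪B, U, a⟫ ⊆ Z := by
  intro b h
  induction h with
  | refl => exact ha
  | tail _ hbc ih => exact hZ _ _ ih hbc

/-- Connection is symmetric. -/
theorem clus_symm {B : Set (Site 2)} {U : Set (Site 2 × Fin 2)} {a b : Site 2} (h : b ∈ clus⟪B, U, a⟫) :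
    a ∈ clus⟪B, U, b⟫ := by
  induction h with
  | refl => exact mem_clus_self _
  | tail _ hbc ih => exact clus_trans (Relation.ReflTransGen.single (nbr_symm hbc)) ih

/-- Connection is monotone in the set of open labels. -/
theorem clus_mono {B : Set (Site 2)} {U U' : Set (Site 2 × Fin 2)} (hU : U ⊆ U') (a : Site 2) :
    clus⟪B, U, a⟫ ⊆ clus⟪B, U', a⟫ := by
  intro b h
  induction h with
  | refl => exact mem_clus_self _
  | tail _ hbc ih => exact clus_step ih (nbr_mono hU hbc)

/-- The cluster of a vertex of `B` lies in `B`. -/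
theorem clus_subset {B : Set (Site 2)} {U : Set (Site 2 × Fin 2)} {a : Site 2} (ha : a ∈ B) :
    clus⟪B, U, a⟫ ⊆ B :=
  clus_subset_of_closed (fun _ _ _ hxy => hxy.2.1) ha

/-! ### Sides and crossings -/

/-- Vertices of `L` are joined to `L`. -/
theorem mem_side_of_mem {B : Set (Site 2)} {U : Set (Site 2 × Fin 2)} {L : Set (Site 2)} {v : Site 2}
    (hv : v ∈ L) : v ∈ side⟪B, U, L⟫ :=
  ⟨v, hv, mem_clus_self _⟩

/-- `side` propagates along adjacencies. -/
theorem side_step {B : Set (Site 2)} {U : Set (Site 2 × Fin 2)} {L : Set (Site 2)} {p q : Site 2}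
    (hp : p ∈ side⟪B, U, L⟫) (hpq : q ∈ nbr⟪B, U, p⟫) : q ∈ side⟪B, U, L⟫ := by
  obtain ⟨a, ha, h⟩ := hp
  exact ⟨a, ha, clus_step h hpq⟩

/-- `side` propagates along connections. -/
theorem side_trans {B : Set (Site 2)} {U : Set (Site 2 × Fin 2)} {L : Set (Site 2)} {p q : Site 2}
    (hp : p ∈ side⟪B, U, L⟫) (hpq : q ∈ clus⟪B, U, p⟫) : q ∈ side⟪B, U, L⟫ := by
  obtain ⟨a, ha, h⟩ := hp
  exact ⟨a, ha, clus_trans h hpq⟩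

/-- `side` is monotone in the set of open labels. -/
theorem side_mono {B : Set (Site 2)} {U U' : Set (Site 2 × Fin 2)} (hU : U ⊆ U') (L : Set (Site 2)) :
    side⟪B, U, L⟫ ⊆ side⟪B, U', L⟫ := by
  rintro v ⟨a, ha, h⟩
  exact ⟨a, ha, clus_mono hU a h⟩

/-- `joined` is monotone in the set of open labels. -/
theorem joined_mono {B : Set (Site 2)} {U U' : Set (Site 2 × Fin 2)} (hU : U ⊆ U') {L R : Set (Site 2)}
    (h : U ∈ joined⟪B, L, R⟫) : U' ∈ joined⟪B, L, R⟫ := by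
  obtain ⟨a, ha, b, hb, h⟩ := h
  exact ⟨a, ha, b, hb, clus_mono hU a h⟩

/-- A vertex joined to both sides witnesses a crossing. -/
theorem joined_of_side {B : Set (Site 2)} {U : Set (Site 2 × Fin 2)} {L R : Set (Site 2)} {v : Site 2}
    (hL : v ∈ side⟪B, U, L⟫) (hR : v ∈ side⟪B, U, R⟫) : U ∈ joined⟪B, L, R⟫ := by
  obtain ⟨a, ha, hav⟩ := hL
  obtain ⟨b, hb, hbv⟩ := hR
  exact ⟨a, ha, b, hb, clus_trans hav (clus_symm hbv)⟩

/-- A crossing is witnessed by a vertex of `R` joined to `L`. -/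
theorem exists_mem_of_joined {B : Set (Site 2)} {U : Set (Site 2 × Fin 2)} {L R : Set (Site 2)}
    (h : U ∈ joined⟪B, L, R⟫) : ∃ b ∈ R, b ∈ side⟪B, U, L⟫ := by
  obtain ⟨a, ha, b, hb, h⟩ := h
  exact ⟨b, hb, a, ha, h⟩

/-- `joined` is symmetric in the two sides. -/
theorem joined_symm {B : Set (Site 2)} {U : Set (Site 2 × Fin 2)} {L R : Set (Site 2)}
    (h : U ∈ joined⟪B, L, R⟫) : U ∈ joined⟪B, R, L⟫ := by
  obtain ⟨a, ha, b, hb, h⟩ := h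
  exact ⟨b, hb, a, ha, clus_symm h⟩

/-- No crossing means: no vertex is joined to both sides. -/
theorem not_mem_side_of_not_joined {B : Set (Site 2)} {U : Set (Site 2 × Fin 2)} {L R : Set (Site 2)}
    (h : U ∉ joined⟪B, L, R⟫) {v : Site 2} (hL : v ∈ side⟪B, U, L⟫) : v ∉ side⟪B, U, R⟫ :=
  fun hR => h (joined_of_side hL hR)

/-- **Last step**: a vertex joined to `L` is in `L` or has a neighbour (through an open label)
joined to `L`. -/
theorem side_cases {B : Set (Site 2)} {U : Set (Site 2 × Fin 2)} {L : Set (Site 2)} {v : Site 2}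
    (h : v ∈ side⟪B, U, L⟫) : v ∈ L ∨ ∃ p, p ∈ side⟪B, U, L⟫ ∧ v ∈ nbr⟪B, U, p⟫ := by
  obtain ⟨a, ha, hav⟩ := h
  rcases Relation.ReflTransGen.cases_tail hav with rfl | ⟨p, hap, hpv⟩
  · exact Or.inl ha
  · exact Or.inr ⟨p, ⟨a, ha, hap⟩, hpv⟩

/-! ### Dependence on the in-box labels only -/

/-- Adjacency only reads the labels with both ends in `B`. -/
theorem nbr_congr {B : Set (Site 2)} {U U' : Set (Site 2 × Fin 2)}
    (h : ∀ ℓ ∈ labIn⟪B⟫, ℓ ∈ U ↔ ℓ ∈ U') {a b : Site 2} : b ∈ nbr⟪B, U, a⟫ ↔ b ∈ nbr⟪B, U', a⟫ := by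
  constructor
  · rintro ⟨ha, hb, d, ⟨h1, h2⟩ | ⟨h1, h2⟩⟩
    · exact ⟨ha, hb, d, Or.inl ⟨h1, (h (a, d) ⟨ha, h1 ▸ hb⟩).1 h2⟩⟩
    · exact ⟨ha, hb, d, Or.inr ⟨h1, (h (b, d) ⟨hb, h1 ▸ ha⟩).1 h2⟩⟩
  · rintro ⟨ha, hb, d, ⟨h1, h2⟩ | ⟨h1, h2⟩⟩
    · exact ⟨ha, hb, d, Or.inl ⟨h1, (h (a, d) ⟨ha, h1 ▸ hb⟩).2 h2⟩⟩
    · exact ⟨ha, hb, d, Or.inr ⟨h1, (h (b, d) ⟨hb, h1 ▸ ha⟩).2 h2⟩⟩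

/-- Clusters only read the labels with both ends in `B`. -/
theorem clus_congr {B : Set (Site 2)} {U U' : Set (Site 2 × Fin 2)}
    (h : ∀ ℓ ∈ labIn⟪B⟫, ℓ ∈ U ↔ ℓ ∈ U') (a : Site 2) : clus⟪B, U, a⟫ = clus⟪B, U', a⟫ := by
  ext b
  constructor
  · intro hb
    induction hb with
    | refl => exact mem_clus_self _
    | tail _ hbc ih => exact clus_step ih ((nbr_congr h).1 hbc)
  · intro hb
    induction hb with
    | refl => exact mem_clus_self _
    | tail _ hbc ih => exact clus_step ih ((nbr_congr h).2 hbc)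

/-- `joined` only reads the labels with both ends in `B`. -/
theorem joined_congr {B : Set (Site 2)} {U U' : Set (Site 2 × Fin 2)}
    (h : ∀ ℓ ∈ labIn⟪B⟫, ℓ ∈ U ↔ ℓ ∈ U') {L R : Set (Site 2)} :
    U ∈ joined⟪B, L, R⟫ ↔ U' ∈ joined⟪B, L, R⟫ := by
  constructor
  · rintro ⟨a, ha, b, hb, h'⟩
    exact ⟨a, ha, b, hb, (Set.ext_iff.1 (clus_congr h a) b).1 h'⟩
  · rintro ⟨a, ha, b, hb, h'⟩
    exact ⟨a, ha, b, hb, (Set.ext_iff.1 (clus_congr h a) b).2 h'⟩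

/-! ### Adding one open edge -/

/-- **Opening one label.** If `L ↮ R` for `U` but `L ↔ R` for `U ∪ {ℓ}`, where the label `ℓ`
joins `x` and `y`, then `x ↔ L` and `y ↔ R`, or `y ↔ L` and `x ↔ R` (all for `U`). -/
theorem add_edge {B : Set (Site 2)} {U : Set (Site 2 × Fin 2)} {L R : Set (Site 2)} {ℓ : Site 2 × Fin 2}
    {x y : Site 2} (hxy : y ∈ nbr⟪B, ({ℓ} : Set (Site 2 × Fin 2)), x⟫) (hno : U ∉ joined⟪B, L, R⟫)
    (hyes : U ∪ {ℓ} ∈ joined⟪B, L, R⟫) :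
    (x ∈ side⟪B, U, L⟫ ∧ y ∈ side⟪B, U, R⟫) ∨ (y ∈ side⟪B, U, L⟫ ∧ x ∈ side⟪B, U, R⟫) := by
  obtain ⟨b, hb, a, ha, hab⟩ := exists_mem_of_joined hyes
  -- from an end `z` of `ℓ` joined to `L`, the other end is joined to `R`
  have key : ∀ {z z' : Site 2}, z' ∈ nbr⟪B, ({ℓ} : Set (Site 2 × Fin 2)), z⟫ → z ∈ side⟪B, U, L⟫ →
      z' ∈ side⟪B, U, R⟫ := by
    intro z z' hzz' hz
    have hcl : ∀ p q, p ∈ side⟪B, U, L⟫ ∪ clus⟪B, U, z'⟫ → q ∈ nbr⟪B, U ∪ {ℓ}, p⟫ →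
        q ∈ side⟪B, U, L⟫ ∪ clus⟪B, U, z'⟫ := by
      intro p q hp hpq
      rcases nbr_union_iff.1 hpq with hpq | hpq
      · rcases hp with hp | hp
        · exact Or.inl (side_step hp hpq)
        · exact Or.inr (clus_step hp hpq)
      · rcases nbr_singleton_mem hzz' hpq with rfl | rfl
        · exact Or.inl hz
        · exact Or.inr (mem_clus_self _)
    have hbZ : b ∈ side⟪B, U, L⟫ ∪ clus⟪B, U, z'⟫ :=
      clus_subset_of_closed hcl (Or.inl (mem_side_of_mem ha)) hab
    rcases hbZ with hbL | hbz
    · exact absurd (joined_of_side hbL (mem_side_of_mem hb)) hno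
    · exact ⟨b, hb, clus_symm hbz⟩
  -- one end of `ℓ` is joined to `L`
  by_cases hx : x ∈ side⟪B, U, L⟫
  · exact Or.inl ⟨hx, key hxy hx⟩
  · by_cases hy : y ∈ side⟪B, U, L⟫
    · exact Or.inr ⟨hy, key (nbr_symm hxy) hy⟩
    · exfalso
      have hcl : ∀ p q, p ∈ side⟪B, U, L⟫ → q ∈ nbr⟪B, U ∪ {ℓ}, p⟫ → q ∈ side⟪B, U, L⟫ := by
        intro p q hp hpq
        rcases nbr_union_iff.1 hpq with hpq | hpq
        · exact side_step hp hpq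
        · rcases nbr_singleton_mem hxy (nbr_symm hpq) with rfl | rfl
          · exact absurd hp hx
          · exact absurd hp hy
      have hbL : b ∈ side⟪B, U, L⟫ := clus_subset_of_closed hcl (mem_side_of_mem ha) hab
      exact hno (joined_of_side hbL (mem_side_of_mem hb))

/-- **One step of the surgery.** If `L ↮ R`, `p ↔ L`, the label `ℓ` joins `p` to `q` and
`q ↮ R`, then after opening `ℓ` the sides are still disconnected and `q ↔ L`. -/
theorem one_step {B : Set (Site 2)} {U : Set (Site 2 × Fin 2)} {L R : Set (Site 2)} {ℓ : Site 2 × Fin 2}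
    {p q : Site 2} (hpq : q ∈ nbr⟪B, ({ℓ} : Set (Site 2 × Fin 2)), p⟫) (hno : U ∉ joined⟪B, L, R⟫)
    (hp : p ∈ side⟪B, U, L⟫) (hq : q ∉ side⟪B, U, R⟫) :
    U ∪ {ℓ} ∉ joined⟪B, L, R⟫ ∧ q ∈ side⟪B, U ∪ {ℓ}, L⟫ := by
  refine ⟨fun hyes => ?_,
    side_step (side_mono Set.subset_union_left L hp) (nbr_mono Set.subset_union_right hpq)⟩
  rcases add_edge hpq hno hyes with ⟨-, hqR⟩ | ⟨-, hpR⟩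
  · exact hq hqR
  · exact hno (joined_of_side hp hpR)

end Cone3

/-- **Registered sub-goal `stub_cone3_graphA` of stub `stub_cone3`**: the "adding one open edge"
lemma (`Cone3.add_edge`) written out without notations — if the sides `L`, `R` of the box `B` are
not joined by the open labels `U` but are joined once the label `ℓ = {x, y}` is opened, then `x` is
joined to `L` and `y` to `R`, or `y` to `L` and `x` to `R`. -/
theorem stub_cone3_graphA : ∀ (B : Set (Site 2)) (U : Set (Site 2 × Fin 2)) (L R : Set (Site 2)) (ℓ : Site 2 × Fin 2) (x y : Site 2), (x ∈ B ∧ y ∈ B ∧ ∃ d : Fin 2, (y = x + Pi.single d 1 ∧ (x, d) ∈ ({ℓ} : Set (Site 2 × Fin 2))) ∨ (x = y + Pi.single d 1 ∧ (y, d) ∈ ({ℓ} : Set (Site 2 × Fin 2)))) → (¬ ∃ a ∈ L, ∃ b ∈ R, Relation.ReflTransGen (fun p q : Site 2 => p ∈ B ∧ q ∈ B ∧ ∃ d : Fin 2, (q = p + Pi.single d 1 ∧ (p, d) ∈ U) ∨ (p = q + Pi.single d 1 ∧ (q, d) ∈ U)) a b) → (∃ a ∈ L, ∃ b ∈ R,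 Relation.ReflTransGen (fun p q : Site 2 => p ∈ B ∧ q ∈ B ∧ ∃ d : Fin 2, (q = p + Pi.single d 1 ∧ (p, d) ∈ U ∪ {ℓ}) ∨ (p = q + Pi.single d 1 ∧ (q, d) ∈ U ∪ {ℓ})) a b) → ((∃ a ∈ L, Relation.ReflTransGen (fun p q : Site 2 => p ∈ B ∧ q ∈ B ∧ ∃ d : Fin 2, (q = p + Pi.single d 1 ∧ (p, d) ∈ U) ∨ (p = q + Pi.single d 1 ∧ (q, d) ∈ U)) a x) ∧ ∃ b ∈ R, Relation.ReflTransGen (fun p q : Site 2 => p ∈ B ∧ q ∈ B ∧ ∃ d : Fin 2, (q = p + Pi.single d 1 ∧ (p, d) ∈ U) ∨ (p = q + Pi.single d 1 ∧ (q, d) ∈ U)) b y) ∨ ((∃ a ∈ L, Relation.ReflTransGen (fun p q : Site 2 => p ∈ B ∧ q ∈ B ∧ ∃ d : Fin 2, (q = p + Pi.single d 1 ∧ (p, d) ∈ U) ∨ (p = q + Pi.single d 1 ∧ (q, d) ∈ U)) a y) ∧ ∃ b ∈ R, Relation.ReflTransGen (fun p q : Site 2 => p ∈ B ∧ q ∈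 B ∧ ∃ d : Fin 2, (q = p + Pi.single d 1 ∧ (p, d) ∈ U) ∨ (p = q + Pi.single d 1 ∧ (q, d) ∈ U)) b x) := by
  intro B U L R ℓ x y hxy hno hyes
  rcases Cone3.add_edge (B := B) (U := U) (L := L) (R := R) hxy hno hyes with ⟨⟨a, ha, hax⟩, b, hb, hby⟩ | ⟨⟨a, ha, hay⟩, b, hb, hbx⟩
  · exact Or.inl ⟨⟨a, ha, hax⟩, b, hb, hby⟩
  · exact Or.inr ⟨⟨a, ha, hay⟩, b, hb, hbx⟩

end Summit.CriticalPhenomena.CardyFormulaZ2.Cruxes.CriticalPathRSW.FiniteSizeEnvelope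

end
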